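import Literature.Geometry.Lorentzian.CurvatureRegularity
import HarnessLib

/-!
# The curvature, Ricci and scalar curvature of a `C²` metric are continuous

Finite-regularity companion of `Lorentzian/CurvatureRegularity.lean` ("Only the `C^∞` case is
treated" there). For a `C²` pseudo-Riemannian metric the Levi-Civita connection is locally `C¹`
AND locally `C⁰` (`isLocallyContMDiff_leviCivita_holds` with `k = 1, 0`: a `C^n` metric has a
`C^{n-1}` connection, Gallot–Hulin–Lafontaine 2004, Prop. 2.54), and then its curvature tensor is a
CONTINUOUS tensor field: O'Neill 1983, Ch. 3, Lemma 3.35 (`R` is a tensor field), Def. 3.51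
(`Ric`), Def. 3.53 (`S = C(Ric)`), read at regularity `C⁰`. Everything here is PROVED; no
definitions, no named facts; any model with corners (manifolds with boundary included), which is
the setting of conformal compactifications `ḡ = ρ² g⁺ ∈ C²(X̄)` of asymptotically hyperbolic
metrics (Li–Qing–Shi 2017, Def. 2.1; Lemma 1.6: the curvature of `ḡ` is bounded on the compact
`X̄`, whence `|W[g⁺]|_{g⁺} = ρ²|W[ḡ]|_ḡ → 0` at infinity — the first sentence of Step 1 of the
proof of their Thm. 1.8, pp. 12–13).

* `continuousOn_curvature_apply` — for a covariant derivative `cov` on `TM` which is locally `C¹`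
  and locally `C⁰`, and fields `X, Y` of class `C¹` and `Z` of class `C²` on an open set `u`,
  the section `y ↦ R_y(X_y, Y_y) Z_y` is `C⁰` on `u`: by
  `CovariantDerivative.curvature_apply_of_isLocallyContMDiff` it is
  `∇_X ∇_Y Z − ∇_Y ∇_X Z − ∇_{[X,Y]} Z`, where `∇Z` is `C¹`, `∇_Y Z` is `C¹`, `∇(∇_Y Z)` is `C⁰`
  (this is where local `C⁰`-regularity — `C¹` sections go to `C⁰` sections — is used) and
  `[X, Y]` is `C⁰`;
* `continuousOn_ricci_apply` — `x ↦ Ric_x(Y_x, Z_x)` is `C⁰` on the base set of a trivialization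
  (trace in the local frame, `contMDiffAt_localFrame_coeff` at regularity `0`);
* `continuousOn_gram_localFrame`, `continuousOn_gram_localFrame_inv` — for a `C^n` metric, the
  Gram matrix of the local frame and its inverse have `C⁰` entries on the base set;
* `continuousOn_trace_ricci_baseSet`, `continuous_trace_ricci` — `x ↦ tr_g Ric(cov)_x` is
  continuous;
* `continuousOn_curvatureForm_localFrame`, `continuousOn_ricci_localFrame` — the components
  `Rm_x(s_a, s_b, s_c, s_d) = g_x(R_x(s_a, s_b)s_c, s_d)` and `Ric_x(s_a, s_b)` in the local frame
  of a trivialization are continuous on its base set;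
* for the metric itself (`cov = g.leviCivita`, `g` of class `C^n`, `n ≥ 2`):
  `PseudoRiemannianMetric.continuous_scalarCurvature_of_two_le`,
  `.continuousOn_curvatureForm_localFrame_of_two_le`, `.continuousOn_ricci_localFrame_of_two_le`.

## References

* B. O'Neill, *Semi-Riemannian geometry* (1983), Ch. 3, Lemma 3.35, Def. 3.51, Def. 3.53.
  [ONeill1983]
* S. Gallot, D. Hulin, J. Lafontaine, *Riemannian Geometry*, 3rd ed. (2004), Prop. 2.54.
  [GallotHulinLafontaine2004]
* G. Li, J. Qing, Y. Shi, Trans. Amer. Math. Soc. 369 (2017) 4385–4413 (arXiv:1410.6402),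
  Def. 2.1, Lemma 1.6, proof of Thm. 1.8 (pp. 12–13). [LiQingShi2017]
-/

noncomputable section

open Bundle Set NormedSpace FiberBundle VectorField Matrix
open scoped Manifold ContDiff Topology BigOperators

namespace Literature.Geometry.Lorentzian

section Frame

variable {E : Type*} [NormedAddCommGroup E] [NormedSpace ℝ E] {H : Type*} [TopologicalSpace H]
  {I : ModelWithCorners ℝ E H} {M : Type*} [TopologicalSpace M] [ChartedSpace H M]
  [IsManifold I ∞ M] {cov : CovariantDerivative I E (TangentSpace I : M → Type _)}

variable [FiniteDimensional ℝ E] [CompleteSpace E]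

/-- **The curvature of `C²` data is a continuous field** (O'Neill 1983, Ch. 3, Lemma 3.35 at
regularity `C⁰`). For a covariant derivative `cov` on `TM` which is locally `C¹` and locally `C⁰`,
and vector fields `X, Y` of class `C¹` and `Z` of class `C²` on an open set `u`, the field
`y ↦ R_y(X_y, Y_y) Z_y` is `C⁰` on `u`: it is `∇_X ∇_Y Z − ∇_Y ∇_X Z − ∇_{[X,Y]} Z` there
(`CovariantDerivative.curvature_apply_of_isLocallyContMDiff`), `∇Z` is a `C¹` section of
`Hom(TM, TM)`, `∇_Y Z`, `∇_X Z` are `C¹`, their total covariant derivatives are `C⁰`, and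
`[X, Y]` is `C⁰` (Mathlib's `ContMDiffOn.clm_bundle_apply`, `ContMDiffAt.mlieBracket_vectorField`).
[cite: ONeill1983, Ch. 3, Lemma 3.35] -/
theorem continuousOn_curvature_apply (h1 : cov.IsLocallyContMDiff 1)
    (h0 : cov.IsLocallyContMDiff 0) {u : Set M} (hu : IsOpen u)
    {X Y Z : Π x : M, TangentSpace I x} (hX : CMDiff[u] 1 (T% X)) (hY : CMDiff[u] 1 (T% Y))
    (hZ : CMDiff[u] 2 (T% Z)) :
    CMDiff[u] 0 (T% (fun y ↦ cov.curvature y (X y) (Y y) (Z y))) := by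
  have hI3 : IsManifold I (minSmoothness ℝ 3) M := by
    rw [minSmoothness_of_isRCLikeNormedField]; infer_instance
  have h11 : (1 : ℕ∞ω) + 1 = 2 := by norm_num
  have h01 : (0 : ℕ∞ω) + 1 = 1 := by norm_num
  have h11c : ((1 : ℕ∞) : ℕ∞ω) + 1 = 2 := by norm_num
  -- `∇ Z` is `C¹` on `u`, hence `∇_Y Z`, `∇_X Z` are `C¹`; their covariant derivatives are `C⁰`
  have hDZ : ContMDiffOn I (I.prod 𝓘(ℝ, E →L[ℝ] E)) 1 (cov.totalCovDeriv Z) u :=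
    (h1 u hu).contMDiff (by rw [h11]; simpa using hZ)
  have hYZ : CMDiff[u] 1 (T% (fun y ↦ cov Z y (Y y))) := hDZ.clm_bundle_apply hY
  have hXZ : CMDiff[u] 1 (T% (fun y ↦ cov Z y (X y))) := hDZ.clm_bundle_apply hX
  have hDYZ : ContMDiffOn I (I.prod 𝓘(ℝ, E →L[ℝ] E)) 0
      (cov.totalCovDeriv (fun y ↦ cov Z y (Y y))) u :=
    (h0 u hu).contMDiff (by rw [h01]; simpa using hYZ)
  have hDXZ : ContMDiffOn I (I.prod 𝓘(ℝ, E →L[ℝ] E)) 0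
      (cov.totalCovDeriv (fun y ↦ cov Z y (X y))) u :=
    (h0 u hu).contMDiff (by rw [h01]; simpa using hXZ)
  have hX0 : CMDiff[u] 0 (T% X) := hX.of_le zero_le_one
  have hY0 : CMDiff[u] 0 (T% Y) := hY.of_le zero_le_one
  have hA : CMDiff[u] 0 (T% (fun y ↦ cov (fun y ↦ cov Z y (Y y)) y (X y))) :=
    hDYZ.clm_bundle_apply hX0
  have hB : CMDiff[u] 0 (T% (fun y ↦ cov (fun y ↦ cov Z y (X y)) y (Y y))) :=
    hDXZ.clm_bundle_apply hY0
  have hbr : CMDiff[u] 0 (T% (mlieBracket I X Y)) := by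
    intro y hy
    haveI : IsManifold I (((1 : ℕ∞) : ℕ∞ω) + 1) M := by rw [h11c]; infer_instance
    have hXy : CMDiffAt 1 (T% X) y := (hX y hy).contMDiffAt (hu.mem_nhds hy)
    have hYy : CMDiffAt 1 (T% Y) y := (hY y hy).contMDiffAt (hu.mem_nhds hy)
    exact (hXy.mlieBracket_vectorField hYy (m := 0) (by simp)).contMDiffWithinAt
  have hDZ0 : ContMDiffOn I (I.prod 𝓘(ℝ, E →L[ℝ] E)) 0 (cov.totalCovDeriv Z) u := hDZ.of_le zero_le_one
  have hC : CMDiff[u] 0 (T% (fun y ↦ cov Z y (mlieBracket I X Y y))) := hDZ0.clm_bundle_apply hbr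
  have haux : CMDiff[u] 0 (T% (CovariantDerivative.curvatureAux cov X Y Z)) := by
    have := (hA.sub_section hB).sub_section hC
    refine this.congr fun y _ ↦ ?_
    simp [CovariantDerivative.curvatureAux]
  refine haux.congr fun y hy ↦ ?_
  rw [Bundle.TotalSpace.mk_inj]
  exact cov.curvature_apply_of_isLocallyContMDiff h1
    (((hX y hy).contMDiffAt (hu.mem_nhds hy)).mdifferentiableAt (by simp))
    (((hY y hy).contMDiffAt (hu.mem_nhds hy)).mdifferentiableAt (by simp))
    (((hZ y hy).contMDiffAt (hu.mem_nhds hy)).of_le (by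
      rw [minSmoothness_of_isRCLikeNormedField]))

variable (e : Trivialization E (TotalSpace.proj : TangentBundle I M → M)) [MemTrivializationAtlas e]

/-- **The Ricci tensor of `C²` data on `C²` fields is continuous, locally** (O'Neill 1983, Ch. 3,
Def. 3.51 at regularity `C⁰`). On the base set of a trivialization `e` of the atlas, for `cov`
locally `C¹` and `C⁰` and fields `Y` of class `C¹`, `Z` of class `C²` there, `x ↦ Ric_x(Y_x, Z_x)`
is `C⁰`: in the local frame `sₖ` of `e`, `Ric_x(Y_x, Z_x) = ∑ₖ coeffₖ(x)(R_x(sₖ x, Y_x) Z_x)`,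
the fields `x ↦ R_x(sₖ x, Y_x) Z_x` are `C⁰` (`continuousOn_curvature_apply`) and so are their
frame coefficients (Mathlib's `contMDiffAt_localFrame_coeff`). [cite: ONeill1983, Ch. 3, Def. 3.51] -/
theorem continuousOn_ricci_apply (h1 : cov.IsLocallyContMDiff 1) (h0 : cov.IsLocallyContMDiff 0)
    {Y Z : Π x : M, TangentSpace I x}
    (hY : CMDiff[e.baseSet] 1 (T% Y)) (hZ : CMDiff[e.baseSet] 2 (T% Z)) :
    CMDiff[e.baseSet] 0 (fun x ↦ cov.ricci x (Y x) (Z x)) := by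
  classical
  set bE := Module.finBasis ℝ E with hbE
  -- the frame fields and the curvature fields `W k x = R_x(s_k x, Y x) Z x`
  set s : Fin (Module.finrank ℝ E) → Π x : M, TangentSpace I x := e.localFrame bE with hsdef
  have hs : ∀ k, CMDiff[e.baseSet] 1 (T% (s k)) := fun k ↦
    e.contMDiffOn_localFrame_baseSet (I := I) 1 bE k
  set W : Fin (Module.finrank ℝ E) → Π x : M, TangentSpace I x :=
    fun k x ↦ cov.curvature x (s k x) (Y x) (Z x) with hW
  have hWs : ∀ k, CMDiff[e.baseSet] 0 (T% (W k)) := fun k ↦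
    continuousOn_curvature_apply h1 h0 e.open_baseSet (hs k) hY hZ
  -- the formula on the base set
  have formula : ∀ x ∈ e.baseSet,
      cov.ricci x (Y x) (Z x) = ∑ k, e.localFrame_coeff I bE k x (W k x) := by
    intro x hx
    haveI : FiniteDimensional ℝ (TangentSpace I x) := ‹FiniteDimensional ℝ E›
    rw [CovariantDerivative.ricci_apply, LinearMap.trace_eq_matrix_trace ℝ (e.basisAt bE hx),
      Matrix.trace]
    refine Finset.sum_congr rfl fun k _ ↦ ?_
    rw [Matrix.diag_apply, LinearMap.toMatrix_apply, CovariantDerivative.ricciAux_apply,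
      e.localFrame_coeff_apply_of_mem_baseSet bE hx, hW]
    simp only [hsdef, e.localFrame_apply_of_mem_baseSet bE hx]
  -- continuity of the right-hand side
  have hrhs : CMDiff[e.baseSet] 0 (fun x ↦ ∑ k, e.localFrame_coeff I bE k x (W k x)) := by
    intro x hx
    refine (contMDiffAt_finsetSum fun k _ ↦ ?_).contMDiffWithinAt
    exact contMDiffAt_localFrame_coeff bE hx ((hWs k x hx).contMDiffAt
      (e.open_baseSet.mem_nhds hx)) k
  exact hrhs.congr formula

variable {n : ℕ∞ω} (g : PseudoRiemannianMetric I n E (TangentSpace I : M → Type _))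

omit [FiniteDimensional ℝ E] [CompleteSpace E] in
/-- The entries `G(x)ᵢⱼ = g_x(sᵢ x, sⱼ x)` of the Gram matrix of the local frame of a `C^n`
metric are continuous on the base set (`contMDiffAt_val_apply` at regularity `0`). [folklore] -/
theorem continuousOn_gram_localFrame {ι : Type*} (bE : Module.Basis ι ℝ E) (i j : ι) :
    CMDiff[e.baseSet] 0 (fun x ↦ g.val x (e.localFrame bE i x) (e.localFrame bE j x)) := by
  intro x hx
  have hs := fun k ↦
    (e.contMDiffOn_localFrame_baseSet (I := I) 0 bE k x hx).contMDiffAt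
      (e.open_baseSet.mem_nhds hx)
  exact (g.contMDiffAt_val_apply (zero_le) (hs i) (hs j)).contMDiffWithinAt

omit [FiniteDimensional ℝ E] [CompleteSpace E] in
/-- The Gram matrix of the local frame of any pseudo-Riemannian metric is invertible on the base
set (`det_gram_ne_zero` for the basis `e.basisAt`). [folklore] -/
theorem det_gram_localFrame_ne_zero' {ι : Type*} [Fintype ι] [DecidableEq ι]
    (bE : Module.Basis ι ℝ E) {x : M} (hx : x ∈ e.baseSet) :
    (Matrix.of fun i j ↦ g.val x (e.localFrame bE i x) (e.localFrame bE j x)).det ≠ 0 := by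
  have := det_gram_ne_zero g x (e.basisAt bE hx)
  simpa only [e.localFrame_apply_of_mem_baseSet bE hx] using this

omit [FiniteDimensional ℝ E] [CompleteSpace E] in
/-- **The inverse metric `g^{ij}` of a `C^n` metric in the local frame is continuous**: the entries
of the inverse Gram matrix are `C⁰` on the base set (`contMDiffAt_matrix_inv`). [folklore] -/
theorem continuousOn_gram_localFrame_inv {ι : Type*} [Fintype ι] [DecidableEq ι]
    (bE : Module.Basis ι ℝ E) (i j : ι) :
    CMDiff[e.baseSet] 0 (fun x ↦
      (Matrix.of fun i j ↦ g.val x (e.localFrame bE i x) (e.localFrame bE j x))⁻¹ i j) :=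
  fun x hx ↦ (contMDiffAt_matrix_inv
    (A := fun x ↦ Matrix.of fun i j ↦ g.val x (e.localFrame bE i x) (e.localFrame bE j x))
    (fun i j ↦ (continuousOn_gram_localFrame e g bE i j x hx).contMDiffAt
      (e.open_baseSet.mem_nhds hx)) (det_gram_localFrame_ne_zero' e g bE hx) i j).contMDiffWithinAt

/-- **The scalar curvature of `C²` data is continuous, locally** (O'Neill 1983, Ch. 3, Def. 3.53
at regularity `C⁰`): on the base set of a trivialization of the atlas,
`tr_g Ric(cov)_x = ∑ᵢⱼ (G(x)⁻¹)ⱼᵢ Ric_x(sᵢ x, sⱼ x)` (`trace_eq_sum_gram_inv`), a finite sum of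
products of continuous functions. [cite: ONeill1983, Ch. 3, Def. 3.53] -/
theorem continuousOn_trace_ricci_baseSet (h1 : cov.IsLocallyContMDiff 1)
    (h0 : cov.IsLocallyContMDiff 0) :
    CMDiff[e.baseSet] 0 (fun x ↦ g.trace x (cov.ricci x)) := by
  classical
  set bE := Module.finBasis ℝ E with hbE
  have formula : ∀ x ∈ e.baseSet, g.trace x (cov.ricci x) =
      ∑ i, ∑ j, (Matrix.of fun i j ↦ g.val x (e.localFrame bE i x) (e.localFrame bE j x))⁻¹ j i *
        cov.ricci x (e.localFrame bE i x) (e.localFrame bE j x) := by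
    intro x hx
    rw [trace_eq_sum_gram_inv g x (e.basisAt bE hx)]
    simp only [e.localFrame_apply_of_mem_baseSet bE hx]
  have hrhs : CMDiff[e.baseSet] 0 (fun x ↦
      ∑ i, ∑ j, (Matrix.of fun i j ↦ g.val x (e.localFrame bE i x) (e.localFrame bE j x))⁻¹ j i *
        cov.ricci x (e.localFrame bE i x) (e.localFrame bE j x)) := by
    intro x hx
    refine (contMDiffAt_finsetSum fun i _ ↦ contMDiffAt_finsetSum fun j _ ↦ ?_).contMDiffWithinAt
    refine ((continuousOn_gram_localFrame_inv e g bE j i x hx).contMDiffAt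
      (e.open_baseSet.mem_nhds hx)).mul ?_
    exact (continuousOn_ricci_apply e h1 h0 (e.contMDiffOn_localFrame_baseSet (I := I) 1 bE i)
      (e.contMDiffOn_localFrame_baseSet (I := I) 2 bE j) x hx).contMDiffAt
      (e.open_baseSet.mem_nhds hx)
  exact hrhs.congr formula

/-- **The curvature components in a local frame are continuous**: for `cov` locally `C¹` and `C⁰`
and a `C^n` metric `g`, the functions `x ↦ Rm_x(s_a x, s_b x, s_c x, s_d x) =
g_x(R_x(s_a x, s_b x) s_c x, s_d x)` (the covariant curvature tensor; this is
`PseudoRiemannianMetric.curvatureForm` of `Riemannian/IsotropicCurvature.lean`, unfolded) of the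
local frame `s` of a trivialization are `C⁰` on its base set. [cite: ONeill1983, Ch. 3, Lemma 3.35] -/
theorem continuousOn_curvatureForm_localFrame (h1 : cov.IsLocallyContMDiff 1)
    (h0 : cov.IsLocallyContMDiff 0) {ι : Type*} (bE : Module.Basis ι ℝ E) (a b c d : ι) :
    CMDiff[e.baseSet] 0 (fun x ↦ g.val x (cov.curvature x (e.localFrame bE a x)
      (e.localFrame bE b x) (e.localFrame bE c x)) (e.localFrame bE d x)) := by
  intro x hx
  have hR : CMDiff[e.baseSet] 0 (T% (fun y ↦ cov.curvature y (e.localFrame bE a y)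
      (e.localFrame bE b y) (e.localFrame bE c y))) :=
    continuousOn_curvature_apply h1 h0 e.open_baseSet
      (e.contMDiffOn_localFrame_baseSet (I := I) 1 bE a)
      (e.contMDiffOn_localFrame_baseSet (I := I) 1 bE b)
      (e.contMDiffOn_localFrame_baseSet (I := I) 2 bE c)
  have hRx := (hR x hx).contMDiffAt (e.open_baseSet.mem_nhds hx)
  have hd := (e.contMDiffOn_localFrame_baseSet (I := I) 0 bE d x hx).contMDiffAt
    (e.open_baseSet.mem_nhds hx)
  exact (g.contMDiffAt_val_apply (zero_le) hRx hd).contMDiffWithinAt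

/-- **The Ricci components in a local frame are continuous**: `x ↦ Ric_x(s_a x, s_b x)` is `C⁰`
on the base set, for `cov` locally `C¹` and `C⁰`. [cite: ONeill1983, Ch. 3, Def. 3.51] -/
theorem continuousOn_ricci_localFrame (h1 : cov.IsLocallyContMDiff 1)
    (h0 : cov.IsLocallyContMDiff 0) {ι : Type*} (bE : Module.Basis ι ℝ E) (a b : ι) :
    CMDiff[e.baseSet] 0 (fun x ↦ cov.ricci x (e.localFrame bE a x) (e.localFrame bE b x)) :=
  continuousOn_ricci_apply e h1 h0 (e.contMDiffOn_localFrame_baseSet (I := I) 1 bE a)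
    (e.contMDiffOn_localFrame_baseSet (I := I) 2 bE b)

/-! ### Global statements -/

/-- **The scalar curvature `x ↦ tr_g Ric(cov)_x` is continuous** for a `C^n` metric `g` and a
covariant derivative on `TM` which is locally `C¹` and locally `C⁰` (O'Neill 1983, Ch. 3,
Def. 3.53), from `continuousOn_trace_ricci_baseSet` at the trivialization at each point.
[cite: ONeill1983, Ch. 3, Def. 3.53] -/
theorem continuous_trace_ricci (h1 : cov.IsLocallyContMDiff 1) (h0 : cov.IsLocallyContMDiff 0) :
    Continuous (fun x ↦ g.trace x (cov.ricci x)) := by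
  have h : CMDiff 0 (fun x ↦ g.trace x (cov.ricci x)) := by
    intro x₀
    have hx₀ := mem_baseSet_trivializationAt E (TangentSpace I : M → Type _) x₀
    exact (continuousOn_trace_ricci_baseSet (trivializationAt E (TangentSpace I : M → Type _) x₀)
      g h1 h0 x₀ hx₀).contMDiffAt
      ((trivializationAt E (TangentSpace I : M → Type _) x₀).open_baseSet.mem_nhds hx₀)
  exact h.continuous

namespace PseudoRiemannianMetric

variable {g}

/-- A Levi-Civita connection of a `C^n` metric, `n ≥ 2`, is locally `C⁰` (it is even locally
`C^{n-1}`; `IsLeviCivita.isLocallyContMDiff` with `k = 0`). [cite: GallotHulinLafontaine2004, Prop. 2.54] -/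
theorem IsLeviCivita.isLocallyContMDiff_zero (h : g.IsLeviCivita cov) (hn : 2 ≤ n) :
    cov.IsLocallyContMDiff 0 := by
  haveI : Fact (1 ≤ n) := ⟨le_trans (by norm_num) hn⟩
  exact h.isLocallyContMDiff 0 (le_trans (by norm_num) hn)

/-- **The scalar curvature of `(g, cov)` is continuous for any Levi-Civita connection `cov` of a
`C^n` metric `g`, `n ≥ 2`** (O'Neill 1983, Ch. 3, Def. 3.53 with Thm. 3.11): such a `cov` is
locally `C¹` and locally `C⁰`. [cite: ONeill1983, Ch. 3, Def. 3.53] -/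
theorem IsLeviCivita.continuous_trace_ricci_of_two_le (h : g.IsLeviCivita cov) (hn : 2 ≤ n) :
    Continuous (fun x ↦ g.trace x (cov.ricci x)) :=
  Lorentzian.continuous_trace_ricci g (h.isLocallyContMDiff_one hn) (h.isLocallyContMDiff_zero hn)

variable (g) [g.HasLeviCivita]

/-- **The scalar curvature of a `C^n` metric, `n ≥ 2`, is continuous** (O'Neill 1983, Ch. 3,
Def. 3.53; the `C^∞` statement is `contMDiff_scalarCurvature`). Any model with corners.
[cite: ONeill1983, Ch. 3, Def. 3.53] -/
theorem continuous_scalarCurvature_of_two_le [Fact (1 ≤ n)] (hn : 2 ≤ n) :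
    Continuous g.scalarCurvature :=
  (isLeviCivita_leviCivita_holds (g := g)).continuous_trace_ricci_of_two_le hn

/-- **The curvature components `Rm_x(s_a, s_b, s_c, s_d)` of a `C^n` metric, `n ≥ 2`, in the local
frame of a trivialization are continuous on its base set** (O'Neill 1983, Ch. 3, Lemma 3.35).
Any model with corners. [cite: ONeill1983, Ch. 3, Lemma 3.35] -/
theorem continuousOn_curvatureForm_localFrame_of_two_le [Fact (1 ≤ n)] (hn : 2 ≤ n)
    {ι : Type*} (bE : Module.Basis ι ℝ E) (a b c d : ι) :
    CMDiff[e.baseSet] 0 (fun x ↦ g.val x (g.leviCivita.curvature x (e.localFrame bE a x)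
      (e.localFrame bE b x) (e.localFrame bE c x)) (e.localFrame bE d x)) :=
  continuousOn_curvatureForm_localFrame e g
    ((isLeviCivita_leviCivita_holds (g := g)).isLocallyContMDiff_one hn)
    ((isLeviCivita_leviCivita_holds (g := g)).isLocallyContMDiff_zero hn) bE a b c d

/-- **The Ricci components `Ric_x(s_a, s_b)` of a `C^n` metric, `n ≥ 2`, in the local frame of a
trivialization are continuous on its base set** (O'Neill 1983, Ch. 3, Def. 3.51). Any model with
corners. [cite: ONeill1983, Ch. 3, Def. 3.51] -/
theorem continuousOn_ricci_localFrame_of_two_le [Fact (1 ≤ n)] (hn : 2 ≤ n)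
    {ι : Type*} (bE : Module.Basis ι ℝ E) (a b : ι) :
    CMDiff[e.baseSet] 0 (fun x ↦ g.ricci x (e.localFrame bE a x) (e.localFrame bE b x)) :=
  continuousOn_ricci_localFrame e
    ((isLeviCivita_leviCivita_holds (g := g)).isLocallyContMDiff_one hn)
    ((isLeviCivita_leviCivita_holds (g := g)).isLocallyContMDiff_zero hn) bE a b

omit [FiniteDimensional ℝ E] [CompleteSpace E] [g.HasLeviCivita] in
/-- **The metric components `g_x(s_a, s_b)` in the local frame are continuous** on the base set,
for a `C^n` metric (any `n`). [folklore] -/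
theorem continuousOn_val_localFrame {ι : Type*} (bE : Module.Basis ι ℝ E) (a b : ι) :
    CMDiff[e.baseSet] 0 (fun x ↦ g.val x (e.localFrame bE a x) (e.localFrame bE b x)) :=
  continuousOn_gram_localFrame e g bE a b

end PseudoRiemannianMetric

end Frame

end Literature.Geometry.Lorentzian
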